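import Literature.Algebra.EuclideanLattices.LLLRunBounds
import Mathlib.Analysis.Convex.KreinMilman
import Mathlib.Analysis.InnerProductSpace.PiL2
import Mathlib.LinearAlgebra.Dual.Lemmas
import Mathlib.LinearAlgebra.Matrix.Adjugate
import Mathlib.LinearAlgebra.Matrix.NonsingularInverse
import HarnessLib

/-!
# Vertices of polyhedra: tight constraints span, Cramer integrality, Hadamard's inequality

Topic `Literature/Barriers/MatrixMultiplication`; part of the PROOF of the catalogue entry
`UnstableTensorBarrier` (Bläser–Lysikov 2020, Thm. 16 ∧ Thm. 17). Everything here is PROVED and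
generic (finite-dimensional real coordinate spaces `J → ℝ`); it supplies the linear-programming
half of the explicit weight bound of `UnstableTensorBarrierWeightBound.lean` (the "weight margin"
lower bound of Bürgisser–Franks–Garg–Oliveira–Walter–Wigderson used in BL's proof of Thm. 17,
[BFGOWW Thm. 6.10]: Cramer's rule plus Hadamard's inequality on an integral vertex system).

## Content

* `exists_mem_extremePoints_forall_le` — a continuous linear functional attains its minimum over
  a nonempty compact set at an extreme point (Krein–Milman lemma applied to the exposed face of
  minimisers; Mathlib `IsCompact.extremePoints_nonempty`).
* `span_tight_eq_top_of_mem_extremePoints` — **vertex lemma**: at an extreme point `w` of the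
  polyhedron `{v | ∀ k, b k ≤ a k ⬝ᵥ v}` (finitely many constraints) the tight constraint vectors
  `{a k | a k ⬝ᵥ w = b k}` span `J → ℝ` (else move along a vector annihilated by them).
* `exists_int_det_mul_eq` — **Cramer integrality**: if `M` and `r` are integral and `M w = r` then
  `det M · w j ∈ ℤ` for every `j`.
* `det_sq_le_prod_sum_sq` — **Hadamard's inequality** `det(M)² ≤ ∏ᵢ ∑ⱼ M_{ij}²` (Gram determinant
  = product of squared Gram–Schmidt norms, in the tree: `det_gram_eq_prod_sq_norm_gramSchmidt`,
  `norm_gramSchmidt_le`).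

## References

* P. Bürgisser, C. Franks, A. Garg, R. Oliveira, M. Walter, A. Wigderson, *Towards a theory of
  non-commutative optimization*, FOCS 2019 = arXiv:1910.12375, §6 (Lemma 6.9, Thm. 6.10: weight
  margin via `α(M) ≥ 1` for integer matrices and Hadamard). Cited through [BlaserLysikov2020],
  proof of Thm. 17.
* A. Schrijver, *Theory of Linear and Integer Programming* (1986), §8 (vertices = basic solutions)
  — folklore.
-/

noncomputable section

open scoped BigOperators Matrix
open _root_.Filter _root_.Topology

namespace Literature.Barriers.MatrixMultiplication

universe u

/-! ## A linear functional is minimised at an extreme point -/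

section Extreme

variable {J : Type*} [Fintype J]

/-- On a nonempty compact subset of `J → ℝ` a continuous linear functional attains its minimum at
an extreme point (the face of minimisers is exposed, hence compact and extreme, and has an
extreme point by the Krein–Milman lemma). [folklore] -/
theorem exists_mem_extremePoints_forall_le {P : Set (J → ℝ)} (hPc : IsCompact P)
    (hPne : P.Nonempty) (l : (J → ℝ) →L[ℝ] ℝ) :
    ∃ w ∈ P.extremePoints ℝ, ∀ v ∈ P, l w ≤ l v := by
  have h : IsExposed ℝ P {y ∈ P | ∀ z ∈ P, (-l) z ≤ (-l) y} := fun _ => ⟨-l, rfl⟩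
  obtain ⟨z, hzP, hz⟩ := hPc.exists_isMaxOn hPne (-l).continuous.continuousOn
  obtain ⟨y, hy⟩ := (h.isCompact hPc).extremePoints_nonempty ⟨z, hzP, fun w hw => hz hw⟩
  refine ⟨y, h.isExtreme.extremePoints_subset_extremePoints hy, fun v hv => ?_⟩
  have := hy.1.2 v hv
  exact neg_le_neg_iff.1 this

end Extreme

/-! ## The vertex lemma -/

section Vertex

variable {J : Type*} [Fintype J] [DecidableEq J] {Kc : Type*} [Fintype Kc]

/-- A linear functional on `J → ℝ` is the dot product with the vector of its values on the
standard basis. [folklore] -/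
theorem dual_apply_eq_dotProduct (f : Module.Dual ℝ (J → ℝ)) (u : J → ℝ) :
    f u = (fun j => f (Pi.single j 1)) ⬝ᵥ u := by
  have hu : u = ∑ j, u j • (Pi.single j (1 : ℝ) : J → ℝ) := by
    conv_lhs => rw [← Finset.univ_sum_single u]
    refine Finset.sum_congr rfl fun j _ => ?_
    rw [← Pi.single_smul, smul_eq_mul, mul_one]
  conv_lhs => rw [hu]
  rw [map_sum]
  simp only [map_smul, smul_eq_mul, dotProduct]
  exact Finset.sum_congr rfl fun j _ => mul_comm _ _

/-- For finitely many strict inequalities `0 < δ k`, some `ε > 0` has `ε |c k| < δ k` for all of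
them. [folklore] -/
theorem exists_pos_forall_mul_abs_lt (c δ : Kc → ℝ) (p : Kc → Prop) (hδ : ∀ k, p k → 0 < δ k) :
    ∃ ε : ℝ, 0 < ε ∧ ∀ k, p k → ε * |c k| < δ k := by
  have hev : ∀ k, ∀ᶠ ε in 𝓝 (0 : ℝ), p k → ε * |c k| < δ k := fun k => by
    by_cases hk : p k
    · have ht : Tendsto (fun ε : ℝ => ε * |c k|) (𝓝 0) (𝓝 0) := by
        simpa using (tendsto_id (x := 𝓝 (0 : ℝ))).mul_const (|c k|)
      exact (ht.eventually_lt_const (hδ k hk)).mono fun ε h _ => h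
    · exact Eventually.of_forall fun ε h => absurd h hk
  have hall : ∀ᶠ ε in 𝓝[>] (0 : ℝ), (0 < ε) ∧ ∀ k, p k → ε * |c k| < δ k :=
    (eventually_mem_nhdsWithin).and ((eventually_all.2 hev).filter_mono nhdsWithin_le_nhds)
  obtain ⟨ε, hε, hεk⟩ := hall.exists
  exact ⟨ε, hε, hεk⟩

/-- **Vertex lemma.** At an extreme point `w` of the polyhedron `{v | ∀ k, b k ≤ a k ⬝ᵥ v}`
(finitely many linear constraints on `J → ℝ`), the tight constraint vectors span the whole space:
otherwise a nonzero `v` annihilated by every tight `a k` gives `w ± εv` in the polyhedron for small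
`ε > 0`, and `w` is the midpoint. [folklore] -/
theorem span_tight_eq_top_of_mem_extremePoints (a : Kc → J → ℝ) (b : Kc → ℝ) {w : J → ℝ}
    (hw : w ∈ Set.extremePoints ℝ {v : J → ℝ | ∀ k, b k ≤ a k ⬝ᵥ v}) :
    Submodule.span ℝ (a '' {k | a k ⬝ᵥ w = b k}) = ⊤ := by
  by_contra hne
  have hlt : Submodule.span ℝ (a '' {k | a k ⬝ᵥ w = b k}) < ⊤ := lt_top_iff_ne_top.2 hne
  obtain ⟨f, hf0, hfker⟩ := Submodule.exists_dual_map_eq_bot_of_lt_top hlt inferInstance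
  set v : J → ℝ := fun j => f (Pi.single j 1) with hv
  have hfv : ∀ u, f u = v ⬝ᵥ u := dual_apply_eq_dotProduct f
  -- `v ≠ 0`
  have hv0 : v ≠ 0 := by
    intro h0
    apply hf0
    refine LinearMap.ext fun u => ?_
    rw [hfv, h0, zero_dotProduct, LinearMap.zero_apply]
  -- `v` is annihilated by the tight constraints
  have htight : ∀ k, a k ⬝ᵥ w = b k → a k ⬝ᵥ v = 0 := fun k hk => by
    have hmem : f (a k) ∈ (Submodule.span ℝ (a '' {k | a k ⬝ᵥ w = b k})).map f :=
      Submodule.mem_map_of_mem (Submodule.subset_span ⟨k, hk, rfl⟩)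
    rw [hfker, Submodule.mem_bot, hfv, dotProduct_comm] at hmem
    exact hmem
  rw [mem_extremePoints] at hw
  obtain ⟨hwP, hwext⟩ := hw
  -- slack of the non-tight constraints
  obtain ⟨ε, hε, hεk⟩ := exists_pos_forall_mul_abs_lt (fun k => a k ⬝ᵥ v)
    (fun k => a k ⬝ᵥ w - b k) (fun k => a k ⬝ᵥ w ≠ b k)
    (fun k hk => sub_pos.2 ((hwP k).lt_of_ne (Ne.symm hk)))
  -- `w ± ε v` lie in the polyhedron
  have hmem : ∀ σ : ℝ, (σ = 1 ∨ σ = -1) → (w + (σ * ε) • v) ∈ {v : J → ℝ | ∀ k, b k ≤ a k ⬝ᵥ v} := by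
    intro σ hσ k
    simp only [dotProduct_add, dotProduct_smul, smul_eq_mul]
    by_cases hk : a k ⬝ᵥ w = b k
    · rw [htight k hk, mul_zero, add_zero, hk]
    · have h1 := hεk k hk
      have h2 : |σ * ε * (a k ⬝ᵥ v)| = ε * |a k ⬝ᵥ v| := by
        rw [abs_mul, abs_mul, abs_of_pos hε]
        rcases hσ with rfl | rfl <;> simp
      have h3 : -(ε * |a k ⬝ᵥ v|) ≤ σ * ε * (a k ⬝ᵥ v) := by
        rw [← h2]; exact neg_abs_le _
      linarith
  have hx₁ := hmem 1 (Or.inl rfl)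
  have hx₂ := hmem (-1) (Or.inr rfl)
  have hseg : w ∈ openSegment ℝ (w + ((1 : ℝ) * ε) • v) (w + ((-1 : ℝ) * ε) • v) := by
    refine ⟨1 / 2, 1 / 2, by norm_num, by norm_num, by norm_num, ?_⟩
    simp only [one_mul, neg_mul, neg_smul, smul_add, smul_neg]
    rw [show (1 / 2 : ℝ) • w + (1 / 2 : ℝ) • ε • v + ((1 / 2 : ℝ) • w + -((1 / 2 : ℝ) • ε • v)) =
      (1 / 2 : ℝ) • w + (1 / 2 : ℝ) • w by abel, ← add_smul]
    norm_num
  have heq := (hwext _ hx₁ _ hx₂ hseg).1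
  have : ((1 : ℝ) * ε) • v = 0 := by
    have h := congrArg (fun u => u - w) heq
    simpa using h
  rw [one_mul, smul_eq_zero] at this
  rcases this with h | h
  · exact hε.ne' h
  · exact hv0 h

end Vertex

/-! ## Cramer integrality -/

section Cramer

variable {J : Type*} [Fintype J] [DecidableEq J]

/-- **Cramer integrality**: for an integer matrix `M` and an integer vector `r`, every real
solution `w` of `M w = r` has `det M · w j ∈ ℤ` (namely `det` of `M` with column `j` replaced by
`r`). [folklore] -/
theorem exists_int_det_mul_eq (Mz : Matrix J J ℤ) (rz : J → ℤ) (w : J → ℝ)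
    (hw : (Mz.map (Int.cast : ℤ → ℝ)) *ᵥ w = fun i => (rz i : ℝ)) (j : J) :
    ∃ N : ℤ, (Mz.map (Int.cast : ℤ → ℝ)).det * w j = N := by
  set M : Matrix J J ℝ := Mz.map (Int.cast : ℤ → ℝ) with hM
  have h1 : M.det • w = M.cramer (fun i => (rz i : ℝ)) := by
    rw [Matrix.cramer_eq_adjugate_mulVec, ← hw, Matrix.mulVec_mulVec, Matrix.adjugate_mul,
      Matrix.smul_mulVec, Matrix.one_mulVec]
  have h2 : M.det * w j = (M.updateCol j fun i => (rz i : ℝ)).det := by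
    have := congrFun h1 j
    rw [Pi.smul_apply, smul_eq_mul] at this
    rw [this, Matrix.cramer_apply]
  refine ⟨(Mz.updateCol j rz).det, ?_⟩
  rw [h2]
  have h3 : (M.updateCol j fun i => (rz i : ℝ)) = (Mz.updateCol j rz).map (Int.cast : ℤ → ℝ) := by
    rw [hM, Matrix.map_updateCol]
    rfl
  rw [h3]
  exact (RingHom.map_det (Int.castRingHom ℝ) (Mz.updateCol j rz)).symm

end Cramer

/-! ## Hadamard's inequality -/

section Hadamard

open Literature.Algebra.EuclideanLattices in
/-- **Hadamard's inequality** on `Fin D`: `det(M)² ≤ ∏ᵢ ∑ⱼ M_{ij}²` (the Gram determinant of the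
rows is `det(M Mᵀ) = det(M)²` and equals the product of the squared Gram–Schmidt norms, each at
most the squared norm of the row). [folklore] -/
theorem det_sq_le_prod_sum_sq_fin {D : ℕ} (M : Matrix (Fin D) (Fin D) ℝ) :
    M.det ^ 2 ≤ ∏ i, ∑ j, M i j ^ 2 := by
  set f : Fin D → EuclideanSpace ℝ (Fin D) := fun i => WithLp.toLp 2 (M i) with hf
  have hgram : Matrix.gram ℝ f = M * Mᵀ := by
    ext i j
    rw [Matrix.gram_apply, Matrix.mul_apply, hf, EuclideanSpace.inner_toLp_toLp]
    simp only [star_trivial, dotProduct, Matrix.transpose_apply]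
    exact Finset.sum_congr rfl fun l _ => mul_comm _ _
  have hdet : (Matrix.gram ℝ f).det = M.det ^ 2 := by
    rw [hgram, Matrix.det_mul, Matrix.det_transpose, sq]
  have hnorm : ∀ i, ‖f i‖ ^ 2 = ∑ j, M i j ^ 2 := fun i => by
    rw [EuclideanSpace.norm_sq_eq]
    refine Finset.sum_congr rfl fun j _ => ?_
    rw [hf]
    simp only [Real.norm_eq_abs, sq_abs]
  rw [← hdet, det_gram_eq_prod_sq_norm_gramSchmidt]
  refine Finset.prod_le_prod (fun i _ => sq_nonneg _) fun i _ => ?_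
  rw [← hnorm i]
  exact pow_le_pow_left₀ (norm_nonneg _) (norm_gramSchmidt_le f i) 2

variable {J : Type*} [Fintype J] [DecidableEq J]

/-- **Hadamard's inequality**: `det(M)² ≤ ∏ᵢ ∑ⱼ M_{ij}²` for a real square matrix. [folklore] -/
theorem det_sq_le_prod_sum_sq (M : Matrix J J ℝ) : M.det ^ 2 ≤ ∏ i, ∑ j, M i j ^ 2 := by
  set e := Fintype.equivFin J with he
  have h := det_sq_le_prod_sum_sq_fin (Matrix.reindex e e M)
  rw [Matrix.det_reindex_self] at h
  refine h.trans_eq ?_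
  simp only [Matrix.reindex_apply, Matrix.submatrix_apply]
  rw [← Fintype.prod_equiv e.symm (fun i => ∑ j, M (e.symm i) (e.symm j) ^ 2)
    (fun i => ∑ j, M i j ^ 2) (fun i => ?_)]
  exact Fintype.sum_equiv e.symm _ _ fun j => rfl

end Hadamard

end Literature.Barriers.MatrixMultiplication

end
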